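import Mathlib
import HarnessLib
import Literature.Analysis.PDE.DivFormLiouville
import Literature.Analysis.FunctionSpaces.SmoothCutoff
import Literature.Analysis.FunctionSpaces.PoincareWirtingerConvex
import Literature.Analysis.FunctionSpaces.BMO
import Summits.NavierStokesRegularity.NavierStokesRegularity.Theorems.PoloidalWindowDoorPoloidalWindowRigidityDivFormCaccioppoli
import Summits.NavierStokesRegularity.NavierStokesRegularity.Theorems.PoloidalWindowDoorPoloidalWindowRigidityDivFormCaccioppoliPowers

/-!
# Route `PoloidalWindowDoor`, crux K2 (stmt-NavierStokesRegularity-19708) — task H5, step M2a: `log u ∈ BMO(ℝⁿ)`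
# for entire weak solutions of `div(a∇u) = 0` (towards `divFormLiouville_holds`, De Giorgi–Nash–Moser)

Seat ns-poloidal-K2-p3 g2 (`ledger fact claim` #1 on `Literature.Analysis.PDE.divFormLiouville`).  Setting = that fact's
rendering with `u ≥ 1`.  Moser 1961 §5 / John–Nirenberg 1961: the logarithm of a positive entire solution has bounded
mean oscillation, with a bound depending only on `n` and `Λ/λ`.  Because the equation holds on ALL of `ℝⁿ`, no
localisation is needed: the logarithmic Caccioppoli inequality (M1b `gradLog_estimate`) with a cutoff of the ball
`B(x₀,2r)` equal to `1` on `B(x₀,r)` gives `∫_{B(x₀,r)} ‖D log u‖² ≤ K₁ r⁻² |B(x₀,r)|`, and the Poincaré–Wirtinger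
inequality on the ball (tree `PoincareWirtingerConvex`) turns this into `⨍_{B} ‖log u − (log u)_B‖ ≤ K` for EVERY ball.

* `exists_ball_cutoff` — cutoffs `χ ∈ C¹_c`, `0 ≤ χ ≤ 1`, `χ = 1` on `B(x₀,r)`, `χ = 0` off `B(x₀,2r)`,
  `‖Dχ‖ ≤ C₀/r` (from `SmoothCutoff.exists_smooth_cutoff`);
* `lintegral_ball_gradLog_sq_le` — `∫⁻_{B(x₀,r)} ‖D(log u)‖ₑ² ≤ K₁ · r⁻² · |B(x₀,r)|`;
* `laverage_oscillation_log_le` — `⨍⁻_{B(x₀,r)} ‖log u − (log u)_{B}‖ₑ ≤ K`;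
* `memBMO_log` — `log u ∈ BMO(ℝⁿ)` with `eBMOSeminorm (log ∘ u) ≤ K(n, λ, Λ, C₀)`.

WHAT THIS IS NOT: not yet the Liouville theorem (M2b crossover, M3, M4 to come); nothing NS-specific.
-/

noncomputable section

open MeasureTheory Set Function Filter Topology Metric
open scoped Matrix ENNReal

-- the summit and its single sub-problem share the name (CONVENTIONS §1), as in every Theorems file
set_option linter.dupNamespace false

namespace Summit.NavierStokesRegularity.NavierStokesRegularity.Theorems.PoloidalWindowDoorPoloidalWindowRigidityDivFormLogBMO

open Summit.NavierStokesRegularity.NavierStokesRegularity.Theorems.PoloidalWindowDoorPoloidalWindowRigidityDivFormCaccioppoli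
open Summit.NavierStokesRegularity.NavierStokesRegularity.Theorems.PoloidalWindowDoorPoloidalWindowRigidityDivFormCaccioppoliPowers
open Literature.Analysis.FunctionSpaces

variable {n : ℕ}

/-! ### Cutoffs for balls -/

/-- **Ball cutoffs.**  There is `C₀ ≥ 0` (depending only on `n`) such that for every `x₀` and `r > 0` there is
`χ ∈ C¹(ℝⁿ)` with compact support, `0 ≤ χ ≤ 1`, `χ = 1` on `B(x₀,r)`, `χ = 0` off `B(x₀,2r)`, `‖Dχ‖ ≤ C₀/r`. -/
theorem exists_ball_cutoff (n : ℕ) : ∃ C₀ : ℝ, 0 ≤ C₀ ∧ ∀ (x₀ : EuclideanSpace ℝ (Fin n)) (r : ℝ), 0 < r →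
    ∃ χ : EuclideanSpace ℝ (Fin n) → ℝ, ContDiff ℝ 1 χ ∧ HasCompactSupport χ ∧ (∀ x, 0 ≤ χ x ∧ χ x ≤ 1) ∧
      (∀ x ∈ ball x₀ r, χ x = 1) ∧ (∀ x, x ∉ ball x₀ (2 * r) → χ x = 0) ∧ ∀ x, ‖fderiv ℝ χ x‖ ≤ C₀ / r := by
  obtain ⟨C, hC0, hC⟩ := exists_smooth_cutoff (volume : Measure (EuclideanSpace ℝ (Fin n)))
  refine ⟨2 * C, by positivity, fun x₀ r hr => ?_⟩
  obtain ⟨χ, hχs, hχ01, hχ1, hχ0, hχD⟩ := hC (ball x₀ (3 / 2 * r)) measurableSet_ball (r / 2) (by positivity)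
  have hzero : ∀ x, x ∉ ball x₀ (2 * r) → χ x = 0 := by
    intro x hx
    refine hχ0 x (Metric.ball_disjoint_ball ?_)
    rw [mem_ball, not_lt] at hx
    linarith
  refine ⟨χ, hχs.of_le (by norm_cast), ?_, hχ01, fun x hx => hχ1 x ?_, hzero, fun x => (hχD x).trans_eq (by ring)⟩
  · refine HasCompactSupport.intro (isCompact_closedBall x₀ (2 * r)) fun x hx => hzero x fun hx' => hx ?_
    exact ball_subset_closedBall hx'
  · rw [mem_ball] at hx
    intro z hz
    rw [mem_ball] at hz ⊢
    calc dist z x₀ ≤ dist z x + dist x x₀ := dist_triangle _ _ _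
      _ < r / 2 + r := by linarith
      _ = 3 / 2 * r := by ring


/-! ### The logarithm of a positive solution -/

variable {a : EuclideanSpace ℝ (Fin n) → Matrix (Fin n) (Fin n) ℝ} {lam Λ : ℝ} {u : EuclideanSpace ℝ (Fin n) → ℝ}

/-- `log u ∈ C¹` for `u ∈ C¹`, `u ≥ 1`. -/
theorem contDiff_log (hu : ContDiff ℝ 1 u) (hu1 : ∀ y, 1 ≤ u y) : ContDiff ℝ 1 fun y => Real.log (u y) := by
  rw [contDiff_iff_contDiffAt]
  intro y
  have hy : u y ≠ 0 := (lt_of_lt_of_le one_pos (hu1 y)).ne'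
  exact (Real.contDiffAt_log.2 hy).comp y hu.contDiffAt

/-- `‖D(log u)‖² = ‖Du‖²/u²`. -/
theorem norm_fderiv_log_sq (hu : ContDiff ℝ 1 u) (hu1 : ∀ y, 1 ≤ u y) (y : EuclideanSpace ℝ (Fin n)) :
    ‖fderiv ℝ (fun y => Real.log (u y)) y‖ ^ 2 = (u y ^ 2)⁻¹ * ‖fderiv ℝ u y‖ ^ 2 := by
  have hupos : 0 < u y := lt_of_lt_of_le one_pos (hu1 y)
  rw [fderiv.log ((hu.differentiable one_ne_zero) y) hupos.ne', norm_smul, mul_pow, Real.norm_eq_abs,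
    abs_inv, inv_pow, sq_abs]

/-- **The gradient of `log u` on a ball**: `∫⁻_{B(x₀,r)} ‖D log u‖ₑ² ≤ (4nΛC₀²2ⁿ/λ) · r⁻² · |B(x₀,r)|`, for a cutoff
constant `C₀` as in `exists_ball_cutoff`. -/
theorem lintegral_ball_gradLog_sq_le (hsymm : ∀ y, (a y).IsSymm) (hlam : 0 < lam)
    (hmeas : ∀ i j, Measurable fun y => a y i j)
    (hell : ∀ y (ξ : Fin n → ℝ), lam * (ξ ⬝ᵥ ξ) ≤ ξ ⬝ᵥ (a y *ᵥ ξ)) (hbd : ∀ y i j, |a y i j| ≤ Λ)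
    (hu : ContDiff ℝ 1 u) (hu1 : ∀ y, 1 ≤ u y)
    (hweak : ∀ η : EuclideanSpace ℝ (Fin n) → ℝ, ContDiff ℝ 1 η → HasCompactSupport η →
      ∫ y, ∑ i, ∑ j, a y i j * fderiv ℝ u y (EuclideanSpace.single i 1) *
        fderiv ℝ η y (EuclideanSpace.single j 1) = 0)
    {C₀ : ℝ} {x₀ : EuclideanSpace ℝ (Fin n)} {r : ℝ} (hr : 0 < r)
    {χ : EuclideanSpace ℝ (Fin n) → ℝ} (hχ : ContDiff ℝ 1 χ) (hχc : HasCompactSupport χ)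
    (hχ1 : ∀ x ∈ ball x₀ r, χ x = 1) (hχ0 : ∀ x, x ∉ ball x₀ (2 * r) → χ x = 0)
    (hχD : ∀ x, ‖fderiv ℝ χ x‖ ≤ C₀ / r) :
    ∫⁻ y in ball x₀ r, ‖fderiv ℝ (fun y => Real.log (u y)) y‖ₑ ^ 2 ≤
      ENNReal.ofReal (4 * (n * Λ) * C₀ ^ 2 * 2 ^ n / lam / r ^ 2) * volume (ball x₀ r) := by
  have hupos : ∀ y, 0 < u y := fun y => lt_of_lt_of_le one_pos (hu1 y)
  have hnΛ : 0 ≤ (n : ℝ) * Λ := by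
    rcases Nat.eq_zero_or_pos n with hn | hn
    · simp [hn]
    · exact mul_nonneg (Nat.cast_nonneg n) ((abs_nonneg _).trans (hbd x₀ ⟨0, hn⟩ ⟨0, hn⟩))
  -- (1) the logarithmic Caccioppoli inequality with this cutoff
  have h1 := gradLog_estimate hsymm hlam hmeas hell hbd hu hu1 hweak hχ hχc
  -- (2) the cutoff gradient: `∫ ‖Dχ‖² ≤ (C₀/r)² |B(x₀, 2r)|`
  have hDχ_out : ∀ x, x ∉ closedBall x₀ (2 * r) → fderiv ℝ χ x = 0 := by
    intro x hx
    have hopen : IsOpen (closedBall x₀ (2 * r))ᶜ := isClosed_closedBall.isOpen_compl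
    have hev : χ =ᶠ[𝓝 x] fun _ => 0 := by
      filter_upwards [hopen.mem_nhds hx] with z hz
      exact hχ0 z fun hz' => hz (ball_subset_closedBall hz')
    rw [hev.fderiv_eq, fderiv_const_apply]
  have hint_Dχ : ∫ y, ‖fderiv ℝ χ y‖ ^ 2 ≤ (C₀ / r) ^ 2 * (volume (closedBall x₀ (2 * r))).toReal := by
    have hcont : Continuous fun y => ‖fderiv ℝ χ y‖ ^ 2 := ((hχ.continuous_fderiv one_ne_zero).norm).pow 2
    have heq : ∫ y, ‖fderiv ℝ χ y‖ ^ 2 = ∫ y in closedBall x₀ (2 * r), ‖fderiv ℝ χ y‖ ^ 2 := by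
      refine (setIntegral_eq_integral_of_forall_compl_eq_zero fun y hy => ?_).symm
      rw [hDχ_out y hy, norm_zero, zero_pow two_ne_zero]
    rw [heq]
    calc ∫ y in closedBall x₀ (2 * r), ‖fderiv ℝ χ y‖ ^ 2
        ≤ ∫ y in closedBall x₀ (2 * r), (C₀ / r) ^ 2 := by
          refine setIntegral_mono_on (hcont.continuousOn.integrableOn_compact (isCompact_closedBall _ _))
            (by simp [measure_closedBall_lt_top]) measurableSet_closedBall fun y _ => ?_
          exact pow_le_pow_left₀ (norm_nonneg _) (hχD y) 2
      _ = (C₀ / r) ^ 2 * (volume (closedBall x₀ (2 * r))).toReal := by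
          rw [setIntegral_const, smul_eq_mul, mul_comm]; rfl
  -- (3) volumes: `|B̄(x₀,2r)| = 2ⁿ |B(x₀,r)|`
  have hvol : volume (closedBall x₀ (2 * r)) = ENNReal.ofReal (2 ^ n) * volume (ball x₀ r) := by
    rcases Nat.eq_zero_or_pos n with hn | hn
    · subst hn
      have h0 : ∀ s : Set (EuclideanSpace ℝ (Fin 0)), s.Nonempty → s = univ := fun s hs => by
        obtain ⟨p, hp⟩ := hs; exact eq_univ_of_forall fun q => by rwa [Subsingleton.elim q p]
      rw [h0 _ ⟨x₀, mem_closedBall_self (by positivity)⟩, h0 _ ⟨x₀, mem_ball_self hr⟩]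
      simp
    · haveI : Nonempty (Fin n) := ⟨⟨0, hn⟩⟩
      rw [Measure.addHaar_closedBall_eq_addHaar_ball, Measure.addHaar_ball_of_pos _ _ (by positivity : 0 < 2 * r),
        Measure.addHaar_ball_of_pos _ _ hr, ← mul_assoc, ← ENNReal.ofReal_mul (by positivity), mul_pow,
        finrank_euclideanSpace, Fintype.card_fin]
  -- (4) the left side: on the ball `χ = 1` and `‖D log u‖² = ‖Du‖²/u²`
  have hcontL : Continuous fun y => (u y ^ 2)⁻¹ * ‖fderiv ℝ u y‖ ^ 2 :=
    ((hu.continuous.pow 2).inv₀ fun y => (pow_pos (hupos y) 2).ne').mul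
      (((hu.continuous_fderiv one_ne_zero).norm).pow 2)
  have hinvu : Continuous fun y => (u y ^ 2)⁻¹ := (hu.continuous.pow 2).inv₀ fun y => (pow_pos (hupos y) 2).ne'
  have hnu : Continuous fun y => ‖fderiv ℝ u y‖ ^ 2 := ((hu.continuous_fderiv one_ne_zero).norm).pow 2
  have hIfull : Integrable fun y => χ y ^ 2 * (u y ^ 2)⁻¹ * ‖fderiv ℝ u y‖ ^ 2 := by
    have hc : Continuous fun y => χ y ^ 2 * (u y ^ 2)⁻¹ * ‖fderiv ℝ u y‖ ^ 2 :=
      ((hχ.continuous.pow 2).mul hinvu).mul hnu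
    exact hc.integrable_of_hasCompactSupport
      ((hasCompactSupport_testFun (u := u) (g := fun s => (s ^ 2)⁻¹) hχc).mul_right)
  have hball : ∫ y in ball x₀ r, (u y ^ 2)⁻¹ * ‖fderiv ℝ u y‖ ^ 2 ≤
      ∫ y, χ y ^ 2 * (u y ^ 2)⁻¹ * ‖fderiv ℝ u y‖ ^ 2 := by
    calc ∫ y in ball x₀ r, (u y ^ 2)⁻¹ * ‖fderiv ℝ u y‖ ^ 2
        = ∫ y in ball x₀ r, χ y ^ 2 * (u y ^ 2)⁻¹ * ‖fderiv ℝ u y‖ ^ 2 :=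
          setIntegral_congr_fun measurableSet_ball fun y hy => by rw [hχ1 y hy]; ring
      _ ≤ ∫ y, χ y ^ 2 * (u y ^ 2)⁻¹ * ‖fderiv ℝ u y‖ ^ 2 :=
          setIntegral_le_integral hIfull (Eventually.of_forall fun y => by positivity)
  -- assemble in `ℝ`
  have hreal : ∫ y in ball x₀ r, ‖fderiv ℝ (fun y => Real.log (u y)) y‖ ^ 2 ≤
      4 * (n * Λ) * C₀ ^ 2 * 2 ^ n / lam / r ^ 2 * (volume (ball x₀ r)).toReal := by
    have hv : (volume (closedBall x₀ (2 * r))).toReal = 2 ^ n * (volume (ball x₀ r)).toReal := by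
      rw [hvol, ENNReal.toReal_mul, ENNReal.toReal_ofReal (by positivity)]
    have hL : ∫ y in ball x₀ r, ‖fderiv ℝ (fun y => Real.log (u y)) y‖ ^ 2 =
        ∫ y in ball x₀ r, (u y ^ 2)⁻¹ * ‖fderiv ℝ u y‖ ^ 2 :=
      setIntegral_congr_fun measurableSet_ball fun y _ => norm_fderiv_log_sq hu hu1 y
    rw [hL]
    have h2 : lam * ∫ y in ball x₀ r, (u y ^ 2)⁻¹ * ‖fderiv ℝ u y‖ ^ 2 ≤
        4 * (n * Λ) * ((C₀ / r) ^ 2 * (2 ^ n * (volume (ball x₀ r)).toReal)) := by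
      calc lam * ∫ y in ball x₀ r, (u y ^ 2)⁻¹ * ‖fderiv ℝ u y‖ ^ 2
          ≤ lam * ∫ y, χ y ^ 2 * (u y ^ 2)⁻¹ * ‖fderiv ℝ u y‖ ^ 2 := mul_le_mul_of_nonneg_left hball hlam.le
        _ ≤ 4 * (n * Λ) * ∫ y, ‖fderiv ℝ χ y‖ ^ 2 := h1
        _ ≤ 4 * (n * Λ) * ((C₀ / r) ^ 2 * (2 ^ n * (volume (ball x₀ r)).toReal)) := by
            rw [← hv]; exact mul_le_mul_of_nonneg_left hint_Dχ (by positivity)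
    rw [← le_div_iff₀' hlam] at h2
    refine h2.trans (le_of_eq ?_)
    field_simp
  -- convert to `ℝ≥0∞`
  have hnn : 0 ≤ᵐ[volume.restrict (ball x₀ r)] fun y => ‖fderiv ℝ (fun y => Real.log (u y)) y‖ ^ 2 :=
    Eventually.of_forall fun y => by positivity
  have hIball : IntegrableOn (fun y => ‖fderiv ℝ (fun y => Real.log (u y)) y‖ ^ 2) (ball x₀ r) :=
    ((((contDiff_log hu hu1).continuous_fderiv one_ne_zero).norm).pow 2).continuousOn.integrableOn_compact
      (isCompact_closedBall x₀ r) |>.mono_set ball_subset_closedBall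
  calc ∫⁻ y in ball x₀ r, ‖fderiv ℝ (fun y => Real.log (u y)) y‖ₑ ^ 2
      = ∫⁻ y in ball x₀ r, ENNReal.ofReal (‖fderiv ℝ (fun y => Real.log (u y)) y‖ ^ 2) := by
        refine lintegral_congr fun y => ?_
        rw [← ofReal_norm, ← ENNReal.ofReal_pow (norm_nonneg _)]
    _ = ENNReal.ofReal (∫ y in ball x₀ r, ‖fderiv ℝ (fun y => Real.log (u y)) y‖ ^ 2) :=
        (ofReal_integral_eq_lintegral_ofReal hIball hnn).symm
    _ ≤ ENNReal.ofReal (4 * (n * Λ) * C₀ ^ 2 * 2 ^ n / lam / r ^ 2 * (volume (ball x₀ r)).toReal) :=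
        ENNReal.ofReal_le_ofReal hreal
    _ = ENNReal.ofReal (4 * (n * Λ) * C₀ ^ 2 * 2 ^ n / lam / r ^ 2) * volume (ball x₀ r) := by
        rw [ENNReal.ofReal_mul (by positivity), ENNReal.ofReal_toReal measure_ball_lt_top.ne]

/-! ### Mean oscillation of `log u` over balls, and `BMO` -/

/-- Cauchy–Schwarz for a Lebesgue average: `⨍⁻_s g ≤ K` once `∫⁻_s g² ≤ K² · μ s` — in the form
`∫⁻_s g ≤ (∫⁻_s g²)^{1/2} (μ s)^{1/2}`. -/
theorem setLIntegral_le_sqrt_mul {α : Type*} [MeasurableSpace α] (μ : Measure α) (s : Set α) {g : α → ℝ≥0∞}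
    (hg : AEMeasurable g (μ.restrict s)) :
    ∫⁻ y in s, g y ∂μ ≤ (∫⁻ y in s, g y ^ 2 ∂μ) ^ (1 / 2 : ℝ) * (μ s) ^ (1 / 2 : ℝ) := by
  have h := ENNReal.lintegral_mul_le_Lp_mul_Lq (μ.restrict s) Real.HolderConjugate.two_two hg
    (aemeasurable_const (b := (1 : ℝ≥0∞)))
  simp only [Pi.mul_apply, mul_one, lintegral_const, Measure.restrict_apply_univ, ENNReal.rpow_two] at h
  simpa [one_div] using h

/-- **Mean oscillation of `log u` over a ball** (Moser 1961 §5): with the cutoff constant `C₀` of `exists_ball_cutoff`,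
`⨍⁻_{B(x₀,r)} ‖log u − (log u)_{B(x₀,r)}‖ₑ ≤ K`, `K = (2ⁿ(2r)² · 4nΛC₀²2ⁿ/(λr²))^{1/2} = (16·4ⁿ·nΛC₀²/λ)^{1/2}`. -/
theorem laverage_oscillation_log_le (hsymm : ∀ y, (a y).IsSymm) (hlam : 0 < lam)
    (hmeas : ∀ i j, Measurable fun y => a y i j)
    (hell : ∀ y (ξ : Fin n → ℝ), lam * (ξ ⬝ᵥ ξ) ≤ ξ ⬝ᵥ (a y *ᵥ ξ)) (hbd : ∀ y i j, |a y i j| ≤ Λ)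
    (hu : ContDiff ℝ 1 u) (hu1 : ∀ y, 1 ≤ u y)
    (hweak : ∀ η : EuclideanSpace ℝ (Fin n) → ℝ, ContDiff ℝ 1 η → HasCompactSupport η →
      ∫ y, ∑ i, ∑ j, a y i j * fderiv ℝ u y (EuclideanSpace.single i 1) *
        fderiv ℝ η y (EuclideanSpace.single j 1) = 0)
    {C₀ : ℝ}
    (hcut : ∀ (x₀ : EuclideanSpace ℝ (Fin n)) (r : ℝ), 0 < r →
      ∃ χ : EuclideanSpace ℝ (Fin n) → ℝ, ContDiff ℝ 1 χ ∧ HasCompactSupport χ ∧ (∀ x, 0 ≤ χ x ∧ χ x ≤ 1) ∧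
        (∀ x ∈ ball x₀ r, χ x = 1) ∧ (∀ x, x ∉ ball x₀ (2 * r) → χ x = 0) ∧ ∀ x, ‖fderiv ℝ χ x‖ ≤ C₀ / r)
    (x₀ : EuclideanSpace ℝ (Fin n)) {r : ℝ} (hr : 0 < r) :
    ⨍⁻ y in ball x₀ r, ‖Real.log (u y) - ⨍ z in ball x₀ r, Real.log (u z)‖ₑ ∂volume ≤
      ENNReal.ofReal ((2 ^ n * (2 * r) ^ 2 * (4 * (n * Λ) * C₀ ^ 2 * 2 ^ n / lam / r ^ 2)) ^ (1 / 2 : ℝ)) := by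
  obtain ⟨χ, hχ, hχc, hχ01, hχ1, hχ0, hχD⟩ := hcut x₀ r hr
  set f : EuclideanSpace ℝ (Fin n) → ℝ := fun y => Real.log (u y) with hf
  have hfC : ContDiff ℝ 1 f := contDiff_log hu hu1
  have hB0 : volume (ball x₀ r) ≠ 0 := (measure_ball_pos volume x₀ hr).ne'
  have hBt : volume (ball x₀ r) ≠ ∞ := measure_ball_lt_top.ne
  have hnΛ : 0 ≤ (n : ℝ) * Λ := by
    rcases Nat.eq_zero_or_pos n with hn | hn
    · simp [hn]
    · exact mul_nonneg (Nat.cast_nonneg n) ((abs_nonneg _).trans (hbd x₀ ⟨0, hn⟩ ⟨0, hn⟩))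
  -- Poincaré–Wirtinger on the ball (diameter `2r`)
  have hP := lintegral_enorm_sub_setAverage_sq_le (μ := (volume : Measure (EuclideanSpace ℝ (Fin n)))) hfC
    (convex_ball x₀ r) measurableSet_ball hB0 hBt
    ((hfC.continuous.continuousOn.integrableOn_compact (isCompact_closedBall x₀ r)).mono_set ball_subset_closedBall)
    (D := 2 * r) (fun y hy z hz => by
      rw [← dist_eq_norm]
      calc dist y z ≤ dist y x₀ + dist z x₀ := dist_triangle_right _ _ _
        _ ≤ 2 * r := by rw [mem_ball] at hy hz; linarith)
  rw [finrank_euclideanSpace, Fintype.card_fin] at hP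
  -- the gradient bound
  have hG := lintegral_ball_gradLog_sq_le hsymm hlam hmeas hell hbd hu hu1 hweak hr hχ hχc hχ1 hχ0 hχD
  -- `∫⁻_B osc² ≤ K² |B|`
  set K2 : ℝ := 2 ^ n * (2 * r) ^ 2 * (4 * (n * Λ) * C₀ ^ 2 * 2 ^ n / lam / r ^ 2) with hK2
  have hK2nn : 0 ≤ K2 := by rw [hK2]; positivity
  have hsq : ∫⁻ y in ball x₀ r, ‖f y - ⨍ z in ball x₀ r, f z‖ₑ ^ 2 ≤ ENNReal.ofReal K2 * volume (ball x₀ r) := by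
    refine hP.trans ?_
    calc ENNReal.ofReal (2 ^ n * (2 * r) ^ 2) * ∫⁻ y in ball x₀ r, ‖fderiv ℝ f y‖ₑ ^ 2
        ≤ ENNReal.ofReal (2 ^ n * (2 * r) ^ 2) *
            (ENNReal.ofReal (4 * (n * Λ) * C₀ ^ 2 * 2 ^ n / lam / r ^ 2) * volume (ball x₀ r)) := by
          gcongr
      _ = ENNReal.ofReal K2 * volume (ball x₀ r) := by
          rw [hK2, ← mul_assoc, ← ENNReal.ofReal_mul (by positivity)]
  -- Cauchy–Schwarz and division by `|B|`
  have hmeas_osc : AEMeasurable (fun y => ‖f y - ⨍ z in ball x₀ r, f z‖ₑ) (volume.restrict (ball x₀ r)) :=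
    ((hfC.continuous.sub continuous_const).measurable.enorm).aemeasurable
  have hCS := setLIntegral_le_sqrt_mul volume (ball x₀ r) hmeas_osc
  rw [setLAverage_eq]
  refine (ENNReal.div_le_iff hB0 hBt).2 ?_
  calc ∫⁻ y in ball x₀ r, ‖f y - ⨍ z in ball x₀ r, f z‖ₑ
      ≤ (∫⁻ y in ball x₀ r, ‖f y - ⨍ z in ball x₀ r, f z‖ₑ ^ 2) ^ (1 / 2 : ℝ) *
          volume (ball x₀ r) ^ (1 / 2 : ℝ) := hCS
    _ ≤ (ENNReal.ofReal K2 * volume (ball x₀ r)) ^ (1 / 2 : ℝ) * volume (ball x₀ r) ^ (1 / 2 : ℝ) := by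
        gcongr
    _ = ENNReal.ofReal (K2 ^ (1 / 2 : ℝ)) * volume (ball x₀ r) := by
        rw [ENNReal.mul_rpow_of_nonneg _ _ (by norm_num : (0 : ℝ) ≤ 1 / 2),
          ENNReal.ofReal_rpow_of_nonneg hK2nn (by norm_num : (0 : ℝ) ≤ 1 / 2), mul_assoc,
          ← ENNReal.rpow_add_of_nonneg _ _ (by norm_num : (0 : ℝ) ≤ 1 / 2) (by norm_num : (0 : ℝ) ≤ 1 / 2)]
        norm_num

/-- **`log u ∈ BMO(ℝⁿ)` with a universal bound** (Moser 1961 §5; John–Nirenberg 1961): there is `K ≥ 0`, depending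
only on `n`, `λ`, `Λ`, such that for every coefficient field `a` and every `C¹` weak solution `u ≥ 1` of `div(a∇u) = 0`
on all of `ℝⁿ` (in the weak formulation of `Literature.Analysis.PDE.divFormLiouville`),
`‖log u‖_* = eBMOSeminorm (log ∘ u) ≤ K`; in particular `MemBMO (log ∘ u)`. -/
theorem exists_eBMOSeminorm_log_le (n : ℕ) {lam : ℝ} (hlam : 0 < lam) (Λ : ℝ) :
    ∃ K : ℝ, 0 ≤ K ∧ ∀ (a : EuclideanSpace ℝ (Fin n) → Matrix (Fin n) (Fin n) ℝ),
      (∀ i j, Measurable fun y => a y i j) → (∀ y, (a y).IsSymm) →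
      (∀ y (ξ : Fin n → ℝ), lam * (ξ ⬝ᵥ ξ) ≤ ξ ⬝ᵥ (a y *ᵥ ξ)) → (∀ y i j, |a y i j| ≤ Λ) →
      ∀ (u : EuclideanSpace ℝ (Fin n) → ℝ), ContDiff ℝ 1 u → (∀ y, 1 ≤ u y) →
        (∀ η : EuclideanSpace ℝ (Fin n) → ℝ, ContDiff ℝ 1 η → HasCompactSupport η →
          ∫ y, ∑ i, ∑ j, a y i j * fderiv ℝ u y (EuclideanSpace.single i 1) *
            fderiv ℝ η y (EuclideanSpace.single j 1) = 0) →
        eBMOSeminorm (fun y => Real.log (u y)) ≤ ENNReal.ofReal K ∧ MemBMO (fun y => Real.log (u y)) := by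
  obtain ⟨C₀, -, hcut⟩ := exists_ball_cutoff n
  -- the constant of `laverage_oscillation_log_le` does not depend on `r`; name it at `r = 1`
  refine ⟨(2 ^ n * (2 * 1) ^ 2 * (4 * (n * |Λ|) * C₀ ^ 2 * 2 ^ n / lam / 1 ^ 2)) ^ (1 / 2 : ℝ), by positivity,
    fun a hmeas hsymm hell hbd u hu hu1 hweak => ?_⟩
  have hnΛ : (n : ℝ) * Λ = n * |Λ| := by
    rcases Nat.eq_zero_or_pos n with hn | hn
    · simp [hn]
    · rw [abs_of_nonneg ((abs_nonneg _).trans (hbd 0 ⟨0, hn⟩ ⟨0, hn⟩))]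
  have hle : eBMOSeminorm (fun y => Real.log (u y)) ≤
      ENNReal.ofReal ((2 ^ n * (2 * 1) ^ 2 * (4 * (n * |Λ|) * C₀ ^ 2 * 2 ^ n / lam / 1 ^ 2)) ^ (1 / 2 : ℝ)) := by
    refine iSup_le fun x₀ => iSup_le fun r => iSup_le fun hr => ?_
    have h := laverage_oscillation_log_le hsymm hlam hmeas hell hbd hu hu1 hweak hcut x₀ hr
    refine h.trans (le_of_eq ?_)
    congr 2
    rw [hnΛ]
    field_simp
  refine ⟨hle, (contDiff_log hu hu1).continuous.locallyIntegrable, lt_of_le_of_lt hle ENNReal.ofReal_lt_top⟩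

end Summit.NavierStokesRegularity.NavierStokesRegularity.Theorems.PoloidalWindowDoorPoloidalWindowRigidityDivFormLogBMO

end
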